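import Summits.ValiantsHypothesis.ValiantsHypothesis.Theorems.PrincipalMinorColouringBorderBoundedRankTwoTransport

/-!
# Route PrincipalMinorColouring — item `BorderBoundedRank` (stmt-ValiantsHypothesis-3778, ∀ r): the transport half

The closure transport `stub_transport` of the `r = 2` rung (stmt-21038, line `closure_counting`; landed by seat
val-width-21038-p1 in `…BorderBoundedRankTwoTransport`) with colour classes of size `≤ r` instead of `≤ 2`
("2 ↦ r" in the line card): if the coefficient function of `per_n(x+J)` is in the closure of the coefficient
functions of `n!·det(I_R + diag(x∘κ)K)`, `K ∈ ℂ^{R×R}`, classes of `κ` of size `≤ r`, then for every injective placement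
`ζ` of `k` variables and every substitution `S` of constants outside `ζ` with `S(per_n) = Σ_h c_h ∏_{h i} X_{ζ i}`, the
family `c` lies in the closure of `⋃_{s ≤ r·k} ⋃_ι range (nfMap k s ι)` — classes of size `≤ r` put at most `r·k`
variable slots into the bordered matrix.

* `exists_nfMap_eq_coeff_det_one_add_diagonal_mul` — the bordering + Hrubeš–Joglekar Lemma 1 step of
  `coeff_det_one_add_diagonal_mul_mem_NFImage` (seat p1), with the slot count made explicit: the multilinear
  coefficients of `a · det (1 + diag(d) K)`, `d_j = β_j + Σ_{slot q = j} X_{ι q}`, ARE a value of `nfMap k |Q| ι'`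
  (proof adapted verbatim from p1's; only the conclusion changes);
* `coeff_det_one_add_diagonal_mul_mem_iUnion_nfMap` — hence they lie in `⋃_{s ≤ m} ⋃_ι range (nfMap k s ι)` whenever
  `|Q| ≤ m`;
* `transport_le r` — p1's `stub_transport` with `2 ↦ r` (the class size enters only through the slot count
  `Σ_i |κ⁻¹(ζ i)| ≤ r·k`); the continuity step `coeff_linearMap_mem_closure` and the degree box
  `support_approximant_subset` are imported from p1's file unchanged.

Prover seat val-width-21038-p2 g0 (cell val-width); transport argument due to seat val-width-21038-p1 (p577981). No
definitions. Closes NO item (`--supports stmt-ValiantsHypothesis-3778`). VP ≠ VNP is not moved (bounded-colour-class border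
rung inside Hrubeš–Joglekar's read-`k` range; `TotalRankNotQP` untouched).
-/

noncomputable section

-- `Summit.ValiantsHypothesis.ValiantsHypothesis.…` is the tree's mandated single-conjunct layout (Sub = Summit).
set_option linter.dupNamespace false

namespace Summit.ValiantsHypothesis.ValiantsHypothesis.Theorems.BorderBoundedRankTwoClosureCounting

open MvPolynomial Matrix
open Literature.Computability.AlgebraicComplexity

/-- **The approximants in normal form, with the slot count explicit.** For a constant matrix `K`, constants `β`,
and variable slots `slot : Q → Fin R` filled with the variables `X (ι q)`, the `2^k` multilinear coefficients of
`a · det (1 + diag(d) · K)`, `d j = β j + ∑_{slot q = j} X_{ι q}`, are a value of the normal-form coefficient map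
`nfMap k |Q| ι'` for some slot pattern `ι'`: border the matrix once (`det (1 + diag(d) K) = det [[1, diag d], [-K, 1]]`),
so that the variables sit at the `|Q|` positions `(inl j, inr j)`, and apply Hrubeš–Joglekar's Lemma 1
(`exists_det_eq_const_mul_det_normalForm`). (Adapted from seat p1's `coeff_det_one_add_diagonal_mul_mem_NFImage`.)
[cite: HrubesJoglekar2025, Lemma 1 (p. 53:3)] -/
theorem exists_nfMap_eq_coeff_det_one_add_diagonal_mul {R k : ℕ} {Q : Type*} [Fintype Q]
    (K : Matrix (Fin R) (Fin R) ℂ) (d : Fin R → MvPolynomial (Fin k) ℂ) (β : Fin R → ℂ) (slot : Q → Fin R)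
    (ι : Q → Fin k) (a : ℂ)
    (hd : ∀ j, d j = C (β j) + ∑ q, (if slot q = j then (X (ι q) : MvPolynomial (Fin k) ℂ) else 0)) :
    ∃ (ι' : Fin (Fintype.card Q) → Fin k)
      (p : ℂ × Matrix (Fin (Fintype.card Q) ⊕ Fin (Fintype.card Q)) (Fin (Fintype.card Q) ⊕ Fin (Fintype.card Q)) ℂ),
      nfMap k (Fintype.card Q) ι' p = fun h : Fin k → Bool => coeff (monB h) (C a *
        (1 + diagonal d * K.map (fun b : ℂ => (C b : MvPolynomial (Fin k) ℂ))).det) := by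
  classical
  set s := Fintype.card Q with hs
  set e : Fin s ≃ Q := (Fintype.equivFin Q).symm with he
  -- constant part and variable positions of the bordered matrix
  set C₀ : Matrix (Fin R ⊕ Fin R) (Fin R ⊕ Fin R) ℂ := fromBlocks 1 (diagonal β) (-K) 1 with hC₀
  set pos : Fin s → (Fin R ⊕ Fin R) × (Fin R ⊕ Fin R) :=
    fun q => (Sum.inl (slot (e q)), Sum.inr (slot (e q))) with hpos
  set w : Fin s → MvPolynomial (Fin k) ℂ := fun q => X (ι (e q)) with hw
  -- the bordered matrix is `C₀ + ∑_q w_q E_{pos q}`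
  have hB : fromBlocks 1 (diagonal d) (-K.map (fun b : ℂ => (C b : MvPolynomial (Fin k) ℂ))) 1 =
      C₀.map (algebraMap ℂ (MvPolynomial (Fin k) ℂ)) +
        ∑ q, w q • Matrix.single (pos q).1 (pos q).2 (1 : MvPolynomial (Fin k) ℂ) := by
    rw [MvPolynomial.algebraMap_eq]
    refine Matrix.ext fun i j => ?_
    rw [Matrix.add_apply, Matrix.sum_apply]
    simp only [Matrix.smul_apply, Matrix.single_apply, smul_eq_mul, mul_ite, mul_one, mul_zero, hpos]
    rcases i with i | i <;> rcases j with j | j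
    · simp [hC₀, Matrix.one_apply]
    · have hsum : (∑ x : Fin s, if Sum.inl (slot (e x)) = (Sum.inl i : Fin R ⊕ Fin R) ∧
          Sum.inr (slot (e x)) = (Sum.inr j : Fin R ⊕ Fin R) then w x else 0) =
          if i = j then ∑ q, (if slot q = j then (X (ι q) : MvPolynomial (Fin k) ℂ) else 0) else 0 := by
        simp only [Sum.inl.injEq, Sum.inr.injEq, hw]
        rw [Equiv.sum_comp e (fun q => if slot q = i ∧ slot q = j then (X (ι q) : MvPolynomial (Fin k) ℂ) else 0)]
        split_ifs with hij
        · subst hij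
          simp only [and_self]
        · exact Finset.sum_eq_zero fun q _ => if_neg fun h' => hij (h'.1.symm.trans h'.2)
      rw [hsum]
      simp only [hC₀, fromBlocks_apply₁₂, Matrix.map_apply, diagonal_apply]
      split_ifs with hij
      · subst hij
        exact hd i
      · simp
    · simp [hC₀]
    · simp [hC₀, Matrix.one_apply]
  have hdet : (1 + diagonal d * K.map (fun b : ℂ => (C b : MvPolynomial (Fin k) ℂ))).det =
      (fromBlocks 1 (diagonal d) (-K.map (fun b : ℂ => (C b : MvPolynomial (Fin k) ℂ))) 1).det := by
    rw [det_fromBlocks_one₂₂, Matrix.mul_neg, sub_neg_eq_add]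
  obtain ⟨c, H, hcH⟩ := Literature.LinearAlgebra.Matrix.exists_det_eq_const_mul_det_normalForm
    (R' := MvPolynomial (Fin k) ℂ) C₀ pos w
  rw [← hB, MvPolynomial.algebraMap_eq] at hcH
  refine ⟨fun q => ι (e q), (a * c, H), ?_⟩
  funext h
  show coeff (monB h) (C (a * c) * (diagonal (Sum.elim (fun q => (X (ι (e q)) : MvPolynomial (Fin k) ℂ)) 0) +
      H.map (fun b : ℂ => (C b : MvPolynomial (Fin k) ℂ))).det) = coeff (monB h) (C a * (1 + diagonal d *
        K.map (fun b : ℂ => (C b : MvPolynomial (Fin k) ℂ))).det)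
  rw [hdet, hcH, ← mul_assoc, ← map_mul]

/-- With at most `m` variable slots, the multilinear coefficients of `a · det (1 + diag(d) · K)` (as in
`exists_nfMap_eq_coeff_det_one_add_diagonal_mul`) lie in the union of the normal-form images over all slot counts
`s ≤ m`. [cite: HrubesJoglekar2025, Lemma 1 (p. 53:3)] -/
theorem coeff_det_one_add_diagonal_mul_mem_iUnion_nfMap {R k m : ℕ} {Q : Type*} [Fintype Q]
    (K : Matrix (Fin R) (Fin R) ℂ) (d : Fin R → MvPolynomial (Fin k) ℂ) (β : Fin R → ℂ) (slot : Q → Fin R)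
    (ι : Q → Fin k) (a : ℂ)
    (hd : ∀ j, d j = C (β j) + ∑ q, (if slot q = j then (X (ι q) : MvPolynomial (Fin k) ℂ) else 0))
    (hQ : Fintype.card Q ≤ m) :
    (fun h : Fin k → Bool => coeff (monB h) (C a *
      (1 + diagonal d * K.map (fun b : ℂ => (C b : MvPolynomial (Fin k) ℂ))).det)) ∈
      ⋃ (s : Fin (m + 1)), ⋃ (ι' : Fin (s : ℕ) → Fin k), Set.range (nfMap k s ι') := by
  obtain ⟨ι', p, hp⟩ := exists_nfMap_eq_coeff_det_one_add_diagonal_mul K d β slot ι a hd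
  simp only [Set.mem_iUnion, Set.mem_range]
  exact ⟨⟨Fintype.card Q, Nat.lt_succ_of_le hQ⟩, ι', p, hp⟩

/-- **Closure transport with colour classes of size `≤ r`** (the `r = 2` case is the registered `stub_transport`
of line `closure_counting`, seat p1; this is its proof with `2 ↦ r`). If the coefficient vector of `per_n(x+J)` is
in the closure of the coefficient vectors of `n!·det(I_R + diag(x∘κ)K)` (classes of `κ` of size `≤ r`), then for
every injective placement `ζ` of `k` variables and every substitution `S` of constants outside `ζ`, the `2^k`
coefficients `c` of `S(per_n) = Σ_h c_h ∏_{h i} X_{ζ i}` lie in the closure of `⋃_{s ≤ r·k} ⋃_ι range (nfMap k s ι)`.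
[cite: HrubesJoglekar2025, Lemma 1 (p. 53:3)] -/
theorem transport_le (r : ℕ) :
    ∀ (n R : ℕ) (κ : Fin R → Fin n × Fin n), (∀ e, (Finset.univ.filter (fun i => κ i = e)).card ≤ r) →
      (fun m : (Fin n × Fin n) →₀ ℕ => MvPolynomial.coeff m (MvPolynomial.aeval (fun e => MvPolynomial.X e + 1)
          (Literature.Computability.AlgebraicComplexity.perPoly (Fin n) ℂ))) ∈
        closure (Set.range (fun K : Matrix (Fin R) (Fin R) ℂ => fun m : (Fin n × Fin n) →₀ ℕ =>
          MvPolynomial.coeff m (MvPolynomial.C (n.factorial : ℂ) * (1 + Matrix.diagonal (fun i => MvPolynomial.X (κ i)) *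
            K.map (fun a : ℂ => (MvPolynomial.C a : MvPolynomial (Fin n × Fin n) ℂ))).det))) →
      ∀ (k : ℕ) (ζ : Fin k → Fin n × Fin n), Function.Injective ζ →
      ∀ (S : Fin n × Fin n → MvPolynomial (Fin n × Fin n) ℂ) (c : (Fin k → Bool) → ℂ),
        (∀ i, S (ζ i) = X (ζ i)) → (∀ e, (∀ i, ζ i ≠ e) → ∃ a, S e = C a) →
        aeval S (perPoly (Fin n) ℂ) = ∑ h : Fin k → Bool, C (c h) * ∏ i, (if h i then X (ζ i) else 1) →
        c ∈ closure (⋃ (s : Fin (r * k + 1)), ⋃ (ι : Fin (s : ℕ) → Fin k), Set.range (nfMap k s ι)) := by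
  intro n R κ hκ hv k ζ hζ S c hS1 hS2 hS3
  classical
  -- notation: the limit `P = per_n(x+J)` and the approximants `Q K`
  set P : MvPolynomial (Fin n × Fin n) ℂ := aeval (fun e => X e + 1) (perPoly (Fin n) ℂ) with hP
  set Q : Matrix (Fin R) (Fin R) ℂ → MvPolynomial (Fin n × Fin n) ℂ := fun K =>
    C (n.factorial : ℂ) * (1 + diagonal (fun i => X (κ i)) *
      K.map (fun a : ℂ => (C a : MvPolynomial (Fin n × Fin n) ℂ))).det with hQ
  -- the substitution into `k` abstract variables: `X (ζ i) ↦ X i - 1`, every other `x_e ↦ S e - 1`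
  obtain ⟨γ, hγ⟩ : ∃ γ : Fin n × Fin n → ℂ,
      γ = fun e => (if ∃ i, ζ i = e then 0 else coeff 0 (S e)) - 1 := ⟨_, rfl⟩
  obtain ⟨T, hT⟩ : ∃ T : Fin n × Fin n → MvPolynomial (Fin k) ℂ,
      T = fun e => C (γ e) + ∑ i, (if ζ i = e then (X i : MvPolynomial (Fin k) ℂ) else 0) := ⟨_, rfl⟩
  -- (1) `rename ζ ∘ T = S - 1`
  have hTS : ∀ e, rename ζ (T e) = S e - 1 := by
    intro e
    by_cases he : ∃ i, ζ i = e
    · obtain ⟨i, rfl⟩ := he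
      have hsum : (∑ i', (if ζ i' = ζ i then (X i' : MvPolynomial (Fin k) ℂ) else 0)) = X i := by
        simp_rw [hζ.eq_iff]
        rw [Finset.sum_ite_eq' Finset.univ i, if_pos (Finset.mem_univ _)]
      have hex : ∃ i', ζ i' = ζ i := ⟨i, rfl⟩
      simp only [hT, hγ, if_pos hex, hsum, map_add, rename_X, hS1, zero_sub, map_neg, map_one]
      ring
    · have hsum : (∑ i', (if ζ i' = e then (X i' : MvPolynomial (Fin k) ℂ) else 0)) = 0 :=
        Finset.sum_eq_zero fun i' _ => if_neg fun h => he ⟨i', h⟩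
      obtain ⟨a, ha⟩ := hS2 e fun i h => he ⟨i, h⟩
      simp only [hT, hγ, if_neg he, hsum, add_zero, rename_C, ha, coeff_zero_C, map_sub, map_one]
  -- (2) `rename ζ (T P) = S(per_n)`
  have hren : rename ζ (aeval T P) = ∑ h : Fin k → Bool, C (c h) * ∏ i, (if h i then X (ζ i) else 1) := by
    rw [← hS3]
    have h1 : rename ζ (aeval T P) = aeval (fun e => S e - 1) P := by
      rw [← AlgHom.comp_apply, comp_aeval,
        show (fun e => rename ζ (T e)) = (fun e => S e - 1) from funext hTS]
    have h2 : (fun e => aeval (fun e => S e - 1) (X e + 1 : MvPolynomial (Fin n × Fin n) ℂ)) = S := by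
      funext e
      simp
    rw [h1, hP, ← AlgHom.comp_apply, comp_aeval, h2]
  -- (3) the coefficients of `T P` at the multilinear monomials are the `c h`
  have hc : c = fun h => coeff (monB h) ((aeval T).toLinearMap P) := by
    funext h
    rw [AlgHom.toLinearMap_apply, ← coeff_rename_mapDomain ζ hζ, hren]
    have hmon : Finsupp.mapDomain ζ (monB h) =
        ∑ i ∈ Finset.univ.filter (fun i => h i = true), Finsupp.single (ζ i) 1 := by
      rw [monB, Finsupp.mapDomain_finsetSum]
      simp_rw [Finsupp.mapDomain_single]
    rw [hmon, coeff_sum_C_mul_prod_ite_X ζ hζ c h]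
  -- (4) the approximants are supported in the degree-`R` box
  have hsupp : ∀ g ∈ Set.range Q, g.support ⊆
      (Finset.range (R + 1)).biUnion (fun d => (Finset.univ : Finset (Fin n × Fin n)).finsuppAntidiag d) := by
    rintro _ ⟨K, rfl⟩
    exact support_approximant_subset n R κ K
  -- (5) `T` of an approximant is in normal form with at most `r·k` slots
  have hU : ∀ g ∈ Set.range Q, (fun h => coeff (monB h) ((aeval T).toLinearMap g)) ∈
      ⋃ (s : Fin (r * k + 1)), ⋃ (ι : Fin (s : ℕ) → Fin k), Set.range (nfMap k s ι) := by
    rintro _ ⟨K, rfl⟩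
    -- the variable slots: pairs `(i, j)` with `κ j = ζ i`; at most `r` `j` per `i`
    have hcard : Fintype.card (Σ i : Fin k, {j : Fin R // κ j = ζ i}) ≤ r * k := by
      rw [Fintype.card_sigma]
      calc ∑ i, Fintype.card {j : Fin R // κ j = ζ i}
          ≤ ∑ _i : Fin k, r := Finset.sum_le_sum fun i _ => by
            rw [Fintype.card_subtype]; exact hκ (ζ i)
        _ = r * k := by simp [mul_comm]
    have hslots : ∀ j : Fin R, (∑ i, (if ζ i = κ j then (X i : MvPolynomial (Fin k) ℂ) else 0)) =
        ∑ q : (Σ i : Fin k, {j : Fin R // κ j = ζ i}), (if (q.2 : Fin R) = j then X q.1 else 0) := by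
      intro j
      rw [Fintype.sum_sigma]
      refine Finset.sum_congr rfl fun i _ => ?_
      by_cases hij : κ j = ζ i
      · rw [if_pos hij.symm, Finset.sum_eq_single ⟨j, hij⟩]
        · simp
        · intro j' _ hj'
          exact if_neg fun h => hj' (Subtype.ext h)
        · intro h
          exact absurd (Finset.mem_univ _) h
      · rw [if_neg (fun h => hij h.symm)]
        refine (Finset.sum_eq_zero fun j' _ => if_neg fun h => hij ?_).symm
        rw [← h]
        exact j'.2
    have hslot : ∀ j : Fin R, T (κ j) = C (γ (κ j)) +
        ∑ q : (Σ i : Fin k, {j : Fin R // κ j = ζ i}),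
          (if (fun q : (Σ i : Fin k, {j : Fin R // κ j = ζ i}) => (q.2 : Fin R)) q = j then
            (X ((fun q : (Σ i : Fin k, {j : Fin R // κ j = ζ i}) => q.1) q) : MvPolynomial (Fin k) ℂ) else 0) := by
      intro j
      rw [hT]
      dsimp only
      rw [hslots j]
    have h1 : (fun j => aeval T (X (κ j) : MvPolynomial (Fin n × Fin n) ℂ)) = fun j => T (κ j) := by
      funext j
      simp only [aeval_X]
    have h2 : ((aeval T : MvPolynomial (Fin n × Fin n) ℂ → MvPolynomial (Fin k) ℂ) ∘
        fun a : ℂ => (C a : MvPolynomial (Fin n × Fin n) ℂ)) = fun a : ℂ => (C a : MvPolynomial (Fin k) ℂ) :=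
      funext fun a => by simp
    have haeval : aeval T (Q K) = C (n.factorial : ℂ) * (1 + diagonal (fun j => T (κ j)) *
          K.map (fun a : ℂ => (C a : MvPolynomial (Fin k) ℂ))).det := by
      rw [hQ]
      dsimp only
      rw [map_mul, aeval_C, MvPolynomial.algebraMap_eq, AlgHom.map_det, map_add, map_one, map_mul,
        AlgHom.mapMatrix_apply, AlgHom.mapMatrix_apply, diagonal_map (map_zero _), Matrix.map_map, h1, h2]
    rw [AlgHom.toLinearMap_apply, haeval]
    exact coeff_det_one_add_diagonal_mul_mem_iUnion_nfMap (Q := Σ i : Fin k, {j : Fin R // κ j = ζ i}) K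
      (fun j => T (κ j)) (fun j => γ (κ j)) (fun q => (q.2 : Fin R)) (fun q => q.1) (n.factorial : ℂ)
      hslot hcard
  -- (6) the hypothesis in the shape of `coeff_linearMap_mem_closure`, and the transport
  have hf : (fun m => coeff m P) ∈ closure ((fun g : MvPolynomial (Fin n × Fin n) ℂ => fun m => coeff m g) ''
      Set.range Q) := by
    rw [← Set.range_comp]
    exact hv
  rw [hc]
  exact (coeff_linearMap_mem_closure (aeval T).toLinearMap monB hsupp hf hU).2

end Summit.ValiantsHypothesis.ValiantsHypothesis.Theorems.BorderBoundedRankTwoClosureCounting
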